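import Mathlib
import Summits.Schanuel.Schanuel.Statement
import Literature.NumberTheory.Transcendental.RoyCriterion
import Summits.Schanuel.Schanuel.Theorems.SoloBlindPadeExponent
import HarnessLib

/-!
# Nguyen's refined parameter window for Roy's criterion: the correct range, and the printed one

`Summits/Schanuel/Schanuel/Theorems/SoloBlindNguyenWindow.lean` (soloist `solo-Schanuel-blind`,
session 17).

Nguyen Ngoc Ai Van, *A refined criterion for Schanuel's conjecture*, Chamchuri J. Math. 1 (2009),
no. 2, 25–29, replaces Roy's window (1) `max{1,t₀,2t₁} < min{s₀,2s₁}`,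
`max{s₀, s₁+t₁} < u < ½(1+t₀+t₁)` (Roy, Acta Arith. 97 (2001), Conjecture 2) by the printed
window

  (2) `max{1, t₀, 2t₁} < min{s₀, 2s₁} < u < ½(1 + t₀ + t₁)`,

and states (Theorem 1.4): Conjecture 2 for rank `l` at SOME tuple of (2) implies Schanuel in rank
`l`; Schanuel in rank `l` implies Conjecture 2 at EVERY tuple of (2).  The proof offered for the
first assertion (his Theorem 2.2: Siegel's lemma for a zero of order `K` at the origin + Schwarz,
then Cauchy's inequalities as in Roy's §5, 2°) uses two conditions that (2) does not imply:
`s₀ < u` (to absorb the factor `k!`, `k ≤ N^{s₀}`) and `s₁ + t₁ < ½(1+t₀+t₁)` (his condition (3),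
`E r T₁ < K` with `r = 1 + cN^{s₁}`, against (4), `K² log T₁ ≲ Δ T₀ T₁`).  This file records, in
the kernel:

* `schanuelRank_iff_royCriterionAt_of_nguyen` — on the CORRECTED window
  (2′) `max{1,t₀,2t₁} < min{s₀,2s₁} < u`, `s₀ < u`, `max{u, s₁+t₁} < ½(1+t₀+t₁)`
  Roy's equivalence `SchanuelRank l ⟺` (criterion at the tuple) holds.  This is the special case
  `v ∈ (max{u, s₁+t₁}, ½(1+t₀+t₁))` of `schanuelRank_iff_royCriterionAt` (file
  `SoloBlindPadeExponent`), the Padé forms being supplied by Siegel's lemma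
  (`exists_pade_of_lt_half`).  The only widening relative to Roy's (1) is that `s₁ + t₁` may lie in
  `[u, ½(1+t₀+t₁))`.
* `nguyenExample_window'`, `nguyenExample_not_royAdmissible`,
  `schanuelRank_iff_royCriterionAt_nguyenExample` — Nguyen's example (p. 27: `u = 1+ε`,
  `s₁ = ½+ε`, `t₁ = ½+ε/3`, `t₀ = 1+2ε/3`, `1+2ε/3 < s₀ < 1+ε`, `0 < ε < 1/8`) lies in (2′) and
  outside (1) (`s₁ + t₁ = 1 + 4ε/3 > u`), so the equivalence there is a genuine, valid extension.
* `nguyenVacuous_window`, `royCriterionAt_nguyenVacuous` — the printed window (2) also contains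
  tuples with `s₀ > t₀ + t₁`, e.g. `(s₀,s₁,t₀,t₁,u) = (50, 11/20, 1, 2/5, 23/20)`, at which Roy's
  hypothesis is unsatisfiable at every point (`not_royHypothesis_of_lt`: at `m = 0` the integers
  `(D^k P_N)(0,1)`, `k ≤ N^{s₀}`, would all vanish, against Hermite perfectness), so the criterion
  holds there outright in every rank;
* `nguyen_thm14_literal_iff` — consequently the first assertion of Theorem 1.4, read over the
  printed range (2) ("the criterion in rank `l` at some tuple of (2) implies Schanuel in rank `l`"),
  is EQUIVALENT to Schanuel's conjecture in rank `l` itself: it is not established by the paper's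
  §2, whose argument proves exactly the (2′) case.

Conventions: as in Roy (Prop. 3: `0 ≤ k ≤ M^{s₀}`, `0 ≤ n ≤ M^{s₁}`) and in the tree's
`RoyHypothesis`, the exponents `k, m_j` range over `ℕ ∋ 0`; the vacuity statement uses the point
`m = 0`.

References: Nguyen Ngoc Ai Van, Chamchuri J. Math. 1 (2009) no. 2, 25–29 (Conj. 1.3, Thm. 1.4,
Thm. 2.2, example p. 27); D. Roy, *An arithmetic criterion for the values of the exponential
function*, Acta Arith. 97 (2001) 183–194 (Conj. 2, window (1), Prop. 3, §5).
-/

noncomputable section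

open Filter Complex MvPolynomial Metric

namespace Summit.Schanuel.Schanuel.Theorems

open Literature.NumberTheory.Transcendental

/-! ### The corrected window (2′) -/

/-- **Roy's equivalence on Nguyen's corrected window (2′).**  For positive `s₀, s₁, t₀, t₁, u`
with `max{1, t₀, 2t₁} < min{s₀, 2s₁} < u`, `s₀ < u`, `s₁ + t₁ < ½(1+t₀+t₁)` and
`u < ½(1+t₀+t₁)`, `SchanuelRank l ⟺` Roy's criterion in rank `l` at `(s₀, s₁, t₀, t₁, u)`.
Roy's window (1) is the sub-case `s₁ + t₁ < u`. [this work; cite: Nguyen2009, Thm. 1.4 (range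
corrected); Roy2001, Thm. 1, §5] -/
theorem schanuelRank_iff_royCriterionAt_of_nguyen {l : ℕ} {s₀ s₁ t₀ t₁ u : ℝ}
    (hs₀ : 0 < s₀) (hs₁ : 0 < s₁) (ht₀ : 0 < t₀) (ht₁ : 0 < t₁) (hu : 0 < u)
    (h1 : max 1 (max t₀ (2 * t₁)) < min s₀ (2 * s₁)) (h2 : min s₀ (2 * s₁) < u) (hs₀u : s₀ < u)
    (hst : s₁ + t₁ < (1 + t₀ + t₁) / 2) (hu3 : u < (1 + t₀ + t₁) / 2) :
    SchanuelRank l ↔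
      ∀ (y α : Fin l → ℂ), LinearIndependent ℚ y → (∀ j, α j ≠ 0) →
        RoyHypothesis y α s₀ s₁ t₀ t₁ u →
          (l : Cardinal) ≤ Algebra.trdeg ℚ
            ↥(IntermediateField.adjoin ℚ (Set.range y ∪ Set.range α)) := by
  set v : ℝ := (max u (s₁ + t₁) + (1 + t₀ + t₁) / 2) / 2 with hv
  have hmax : max u (s₁ + t₁) < (1 + t₀ + t₁) / 2 := max_lt hu3 hst
  have huv : u < v := by
    have := le_max_left u (s₁ + t₁)
    rw [hv]; linarith
  have hstv : s₁ + t₁ < v := by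
    have := le_max_right u (s₁ + t₁)
    rw [hv]; linarith
  have hv3 : v < (1 + t₀ + t₁) / 2 := by rw [hv]; linarith
  have hMs₀ : max 1 (max t₀ (2 * t₁)) < s₀ := lt_of_lt_of_le h1 (min_le_left _ _)
  have hMv : max 1 (max t₀ (2 * t₁)) < v := hMs₀.trans (hs₀u.trans huv)
  have hMv' : max 1 (max t₀ (2 * t₁)) / 2 + t₁ < v := by
    have h2s₁ : max 1 (max t₀ (2 * t₁)) < 2 * s₁ := lt_of_lt_of_le h1 (min_le_right _ _)
    linarith
  exact schanuelRank_iff_royCriterionAt hs₀ hs₁ ht₀ ht₁ hu h1 h2 hs₀u hstv huv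
    (exists_pade_of_lt_half ht₀ ht₁ hMv hMv' hv3)

/-! ### Nguyen's example: inside (2′), outside Roy's window (1) -/

/-- Nguyen's example tuple (p. 27) satisfies the corrected window (2′): for `ε < 1/8` and
`1 + 2ε/3 < s₀ < 1 + ε` (which forces `0 < ε`), with `u = 1+ε`, `s₁ = ½+ε`, `t₀ = 1+2ε/3`,
`t₁ = ½+ε/3`, all ten hypotheses of `schanuelRank_iff_royCriterionAt_of_nguyen` hold.
[cite: Nguyen2009, p. 27] -/
theorem nguyenExample_window' {ε s₀ : ℝ} (hε' : ε < 1 / 8)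
    (hs₀l : 1 + 2 * ε / 3 < s₀) (hs₀u : s₀ < 1 + ε) :
    0 < s₀ ∧ 0 < 1 / 2 + ε ∧ 0 < 1 + 2 * ε / 3 ∧ 0 < 1 / 2 + ε / 3 ∧ 0 < 1 + ε ∧
      max 1 (max (1 + 2 * ε / 3) (2 * (1 / 2 + ε / 3))) < min s₀ (2 * (1 / 2 + ε)) ∧
      min s₀ (2 * (1 / 2 + ε)) < 1 + ε ∧ s₀ < 1 + ε ∧
      (1 / 2 + ε) + (1 / 2 + ε / 3) < (1 + (1 + 2 * ε / 3) + (1 / 2 + ε / 3)) / 2 ∧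
      1 + ε < (1 + (1 + 2 * ε / 3) + (1 / 2 + ε / 3)) / 2 := by
  refine ⟨by linarith, by linarith, by linarith, by linarith, by linarith, ?_, ?_, hs₀u,
    by linarith, by linarith⟩
  · have hinner : max (1 + 2 * ε / 3) (2 * (1 / 2 + ε / 3)) = 1 + 2 * ε / 3 :=
      max_eq_left (by linarith)
    have hM : max 1 (max (1 + 2 * ε / 3) (2 * (1 / 2 + ε / 3))) = 1 + 2 * ε / 3 := by
      rw [hinner]
      exact max_eq_right (by linarith)
    rw [hM]
    exact lt_min hs₀l (by linarith)
  · exact lt_of_le_of_lt (min_le_left _ _) hs₀u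

/-- Nguyen's example tuple is NOT in Roy's window (1): `s₁ + t₁ = 1 + 4ε/3 > u = 1 + ε`.
[cite: Nguyen2009, p. 27; Roy2001, (1)] -/
theorem nguyenExample_not_royAdmissible {ε s₀ : ℝ} (hε : 0 < ε) :
    ¬ RoyAdmissible s₀ (1 / 2 + ε) (1 + 2 * ε / 3) (1 / 2 + ε / 3) (1 + ε) := by
  rintro ⟨-, -, -, -, -, -, h2, -⟩
  have h := lt_of_le_of_lt (le_max_right _ _) h2
  linarith

/-- **Roy's equivalence at Nguyen's example tuple** (outside Roy's window): for `ε < 1/8` and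
`1 + 2ε/3 < s₀ < 1 + ε` (so `0 < ε`), `SchanuelRank l ⟺` criterion at
`(s₀, ½+ε, 1+2ε/3, ½+ε/3, 1+ε)`. [this work; cite: Nguyen2009, Thm. 1.4 and p. 27] -/
theorem schanuelRank_iff_royCriterionAt_nguyenExample {l : ℕ} {ε s₀ : ℝ}
    (hε' : ε < 1 / 8) (hs₀l : 1 + 2 * ε / 3 < s₀) (hs₀u : s₀ < 1 + ε) :
    SchanuelRank l ↔
      ∀ (y α : Fin l → ℂ), LinearIndependent ℚ y → (∀ j, α j ≠ 0) →
        RoyHypothesis y α s₀ (1 / 2 + ε) (1 + 2 * ε / 3) (1 / 2 + ε / 3) (1 + ε) →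
          (l : Cardinal) ≤ Algebra.trdeg ℚ
            ↥(IntermediateField.adjoin ℚ (Set.range y ∪ Set.range α)) := by
  obtain ⟨h0, h1', h2', h3', h4', h5, h6, h7, h8, h9⟩ := nguyenExample_window' hε' hs₀l hs₀u
  exact schanuelRank_iff_royCriterionAt_of_nguyen h0 h1' h2' h3' h4' h5 h6 h7 h8 h9

/-! ### The printed window (2) contains vacuous tuples -/

/-- The tuple `(s₀, s₁, t₀, t₁, u) = (50, 11/20, 1, 2/5, 23/20)` satisfies Nguyen's printed window
(2): all parameters positive, `max{1, t₀, 2t₁} = 1 < min{s₀, 2s₁} = 11/10 < u = 23/20 <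
½(1+t₀+t₁) = 6/5` — and has `t₀ + t₁ = 7/5 < s₀`. [this work; cite: Nguyen2009, (2)] -/
theorem nguyenVacuous_window :
    (0 : ℝ) < 50 ∧ (0 : ℝ) < 11 / 20 ∧ (0 : ℝ) < 1 ∧ (0 : ℝ) < 2 / 5 ∧ (0 : ℝ) < 23 / 20 ∧
      max (1 : ℝ) (max 1 (2 * (2 / 5))) < min 50 (2 * (11 / 20)) ∧
      min (50 : ℝ) (2 * (11 / 20)) < 23 / 20 ∧ (23 / 20 : ℝ) < (1 + 1 + 2 / 5) / 2 ∧
      (1 : ℝ) + 2 / 5 < 50 := by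
  norm_num

/-- **At that tuple Roy's criterion holds outright, in every rank** (the hypothesis is empty:
`not_royHypothesis_of_lt`). [this work] -/
theorem royCriterionAt_nguyenVacuous (l : ℕ) :
    ∀ (y α : Fin l → ℂ), LinearIndependent ℚ y → (∀ j, α j ≠ 0) →
      RoyHypothesis y α 50 (11 / 20) 1 (2 / 5) (23 / 20) →
        (l : Cardinal) ≤ Algebra.trdeg ℚ
          ↥(IntermediateField.adjoin ℚ (Set.range y ∪ Set.range α)) :=
  royCriterionAt_of_lt_s₀ l (by norm_num) (by norm_num) (by norm_num)

/-- **Theorem 1.4's first assertion over the printed range (2) is equivalent to Schanuel in rank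
`l`.**  The statement "for every tuple of (2): the criterion in rank `l` at that tuple implies
`SchanuelRank l`" (i.e. the criterion at SOME tuple of (2) suffices) implies `SchanuelRank l`
unconditionally — instantiate it at the vacuous tuple of `royCriterionAt_nguyenVacuous` — and is
trivially implied by it.  Hence the paper's §2 (which proves the (2′) case,
`schanuelRank_iff_royCriterionAt_of_nguyen`) does not establish it as printed.
[this work; cite: Nguyen2009, Thm. 1.4] -/
theorem nguyen_thm14_literal_iff (l : ℕ) :
    (∀ (s₀ s₁ t₀ t₁ u : ℝ), 0 < s₀ → 0 < s₁ → 0 < t₀ → 0 < t₁ → 0 < u →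
        max 1 (max t₀ (2 * t₁)) < min s₀ (2 * s₁) → min s₀ (2 * s₁) < u →
        u < (1 + t₀ + t₁) / 2 →
        (∀ (y α : Fin l → ℂ), LinearIndependent ℚ y → (∀ j, α j ≠ 0) →
            RoyHypothesis y α s₀ s₁ t₀ t₁ u →
              (l : Cardinal) ≤ Algebra.trdeg ℚ
                ↥(IntermediateField.adjoin ℚ (Set.range y ∪ Set.range α))) →
          SchanuelRank l) ↔
      SchanuelRank l := by
  refine ⟨fun h => ?_, fun hS _ _ _ _ _ _ _ _ _ _ _ _ _ _ => hS⟩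
  obtain ⟨h0, h1, h2, h3, h4, h5, h6, h7, -⟩ := nguyenVacuous_window
  exact h 50 (11 / 20) 1 (2 / 5) (23 / 20) h0 h1 h2 h3 h4 h5 h6 h7
    (royCriterionAt_nguyenVacuous l)

/-- The same in terms of the summit statement: "Theorem 1.4 (first assertion, printed range) for
every rank" is equivalent to Schanuel's conjecture. [this work] -/
theorem nguyen_thm14_literal_all_iff :
    (∀ l : ℕ, ∀ (s₀ s₁ t₀ t₁ u : ℝ), 0 < s₀ → 0 < s₁ → 0 < t₀ → 0 < t₁ → 0 < u →
        max 1 (max t₀ (2 * t₁)) < min s₀ (2 * s₁) → min s₀ (2 * s₁) < u →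
        u < (1 + t₀ + t₁) / 2 →
        (∀ (y α : Fin l → ℂ), LinearIndependent ℚ y → (∀ j, α j ≠ 0) →
            RoyHypothesis y α s₀ s₁ t₀ t₁ u →
              (l : Cardinal) ≤ Algebra.trdeg ℚ
                ↥(IntermediateField.adjoin ℚ (Set.range y ∪ Set.range α))) →
          SchanuelRank l) ↔
      Schanuel := by
  rw [show Schanuel ↔ ∀ l, SchanuelRank l from
    ⟨fun h l y hy => h l y hy, fun h l y hy => h l y hy⟩]
  exact forall_congr' fun l => nguyen_thm14_literal_iff l

end Summit.Schanuel.Schanuel.Theorems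

end
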